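import Summits.Schanuel.Schanuel.Theorems.RootDecomp1KDegreeLadder01

/-!
# RootDecomp1KDegreeLadder — lens 1, generation 45 «DEGREE LADDER AT FIXED SKEL-QUALITY (DL) + THIN-FIBRE RESIDUAL» (lane K-R30 (b); CLAIM L2155, ACK/CHECKLIST K-g45 L2159, NODE L2213 / REQUEST L2214, writer re-checks L2219/L2221/L2230, critic VERDICT L2216: CLEARED — THEOREM ×1 for DL `degreeLadder`; EDITION 2/3 docstring-only accepted L2224 / files of record L2228 (K ed. 3 f2af863f…); RULE K-R31; lens-1 tally credits ×11 + THEOREM ×2) — continuation (RootDecomp1KDegreeLadder02): §2 truncations + §3 calculus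

(lens-1 g45 HOME kernel K = HOME/decomp-schanuel-lens-1/g45/DegreeLadder.lean EDITION 3 f2af863f…, 2183 l, imports tree `…RootDecomp1KSkelCell01` (the tree now has `…SkelCell10` with §8's `SkelLiouvilleFix`); P DLprobe.lean f44a49e4… rc 0, C DLctrl.lean 394594cd… rc 1 = exactly the 13 planted errors. Port by census-1 gen 19 as `RootDecomp1KDegreeLadder01`–`08` (+ `09` deferred): 01 = K's module doc + §0 residue (`skelLiouvilleFix_of_skelLiouville`, `SkelLiouvilleFix.liouville` / `.transcendental` declared in the TREE namespace `…RootDecomp1KSkelCell` so dot-notation keeps working) + §1 toolkit `bev`/`xdeg`/`dX`/`specX`; 02 = §2 truncations + §3 calculus (`tangent`, Lipschitz, `coeff_specX_bound`); 03 = §4 engine A (`onCurve_exponent_ineq`, `engine_core`); 04 = §4 engine B (`lowDegree_clause`, `engine_of_clause`, `engine`) + §5 THE DEGREE LADDER `degreeLadder (d) (ρ) (hρ : SkelLiouvilleFix (d + 1) ρ) (P : ℤ[X][X]) (hP : P ≠ 0) (hdeg : P.natDegree ≤ d) : bev P (liouvilleNumber 2) ρ ≠ 0` (descent `no_relation_of_engine`);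 05 = §5b limit corollary (`algebraicIndependent_of_forall_fix`) + §5c relative degree (`relDegree_gt`, `skelFix_two_not_mem_adjoin(_complex)`); 06 = §5d the residual `ThinFibre`/`ThinFibreAt` (+ glue `thinFibre_imp_b`) + §6 the toy fibre decided (`sq_fibre_iff`, `toy_clause`); 07 = §7 tightness at d = 1 (`degreeLadder_tight_one`, `rU_injective`, `not_thinFibre_one`, `not_thinFibre_zero`); 08 = §8a the 2-adic mechanism (`two_adic_split`, `two_adic_quality`, hypothesis-free); 09 (DEFERRED until Literature `…DiophantineApproximation.RidoutIntegers` builds on the check farm, rc 75 today) = §8b `isSquare_mul_psNumer_finite`, `isSquare_seventeen_mul_psNumer_finite`, `thinFibreAt_sqMulP` with `Ridout.padicRoth_int` BY NAME (K carries them under a `(hR : PadicRothInt)` binder whose `def` is NOT landed — verdict condition (c)).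
PORT EDITS: import `…SkelCell10` instead of `…SkelCell01` and DELETE K's verbatim copies of the tree's §8 (`SkelLiouvilleFix`, `skelLiouville_iff_fix`, `SkelLiouvilleFix.mono`, `uStar`, `dU`, `rU`, `dU_cast`, `two_pow_le_four_mul_dU`, `two_mul_dU_lt`, `one_le_dU`, `rU_den`, `rU_cast`, `uStar_sub_rU`, `skelLiouvilleFix_one_uStar`, `not_skelFixOne_algebraicIndependent` — 15 blocks, opened from `…RootDecomp1KSkelCell` by name; verdict condition (a)); the file-wide linter option dropped (b); 58 one-line docstrings added to undocumented helper lemmas; 34 small generic ℓ₂/`psNumer`/`partialSum`/cast lemmas made PRIVATE (dedup-safety against tree twins in TwoBaseCell/CommonRadixCell/SkelCell/RadixCell) with per-part private copies; `ThinFibre`/`ThinFibreAt` docstrings carry the residual-class tag (d); graded statements and proofs otherwise verbatim. `--supports stmt-Schanuel-33364`; no census credit carried; rung 0 — nothing here proves Schanuel, `FiniteOrderLiouvilleSchanuel` (33364), `CoordLiouvilleSchanuel` (31077) or (b) at fixed quality.)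
-/

noncomputable section

open Polynomial LiouvilleNumber
open scoped Nat

namespace Summit.Schanuel.Schanuel.Theorems.RootDecomp1KDegreeLadder

open Summit.Schanuel.Schanuel.Theorems.RootDecomp1KSkelCell
  (exists_le_two_pow_factorial iota iota_spec iota_le_of_le pow_lt_of_lt_iota lt_iota_of_pow_lt iota_mono
   one_le_iota SkelLiouville SkelLiouvilleFix skelLiouville_iff_fix SkelLiouvilleFix.mono uStar dU rU dU_cast
   two_pow_le_four_mul_dU two_mul_dU_lt one_le_dU rU_den rU_cast uStar_sub_rU skelLiouvilleFix_one_uStar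
   not_skelFixOne_algebraicIndependent)
open Summit.Schanuel.Schanuel.Theorems.RootDecomp1KTwoBaseCell (psNumer partialSum_eq_psNumer_div coprime_psNumer
  algebraicIndependent_of_forall_int')
open Summit.Schanuel.Schanuel.Theorems.RootDecomp1KRelLiouvilleCell (partialSum_two_strictMono
  partialSum_two_lt_liouvilleNumber abs_liouvilleNumber_two_sub_partialSum)

/-! ## §2  The truncations `s_N = psNumer 2 N / 2^{N!}` of `ℓ₂` and cleared evaluations -/

section Truncations

/-- `ℓ₂ := liouvilleNumber 2`. -/
private theorem ell2_eq (N : ℕ) : liouvilleNumber 2 = partialSum 2 N + remainder 2 N :=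
  (partialSum_add_remainder (by norm_num) N).symm

/-- `s_N = p_N / 2^{N!}` (tree `partialSum_eq_psNumer_div` at `b = 2`). -/
private theorem partialSum_two (N : ℕ) : partialSum 2 N = (psNumer 2 N : ℝ) / (2 : ℝ) ^ N ! := by
  have := partialSum_eq_psNumer_div (b := 2) (by norm_num) N
  simpa using this

/-- `1/2^{(N+1)!} ≤ ℓ₂ − s_N < 2/2^{(N+1)!}`. -/
private theorem remainder_two_lt (N : ℕ) : remainder 2 N < 2 / (2 : ℝ) ^ (N + 1)! := by
  have h := remainder_lt' N (m := (2 : ℝ)) (by norm_num)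
  have e : (1 - 1 / (2 : ℝ))⁻¹ * (1 / 2 ^ (N + 1)!) = 2 / (2 : ℝ) ^ (N + 1)! := by
    rw [div_eq_mul_inv (2 : ℝ) (2 ^ (N + 1)!), one_div]
    norm_num
  linarith [h, e]

/-- `1/2^{(N+1)!} ≤ ℓ₂ − s_N`. -/
private theorem le_remainder_two (N : ℕ) : 1 / (2 : ℝ) ^ (N + 1)! ≤ remainder 2 N := by
  unfold remainder
  have hs : Summable fun i : ℕ => 1 / (2 : ℝ) ^ (i + (N + 1))! := by
    simpa using remainder_summable (m := (2 : ℝ)) (by norm_num) N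
  have := hs.le_tsum 0 (fun i _ => by positivity)
  simpa using this

/-- `0 < ℓ₂ − s_N`. -/
private theorem remainder_two_pos (N : ℕ) : 0 < remainder 2 N := remainder_pos (by norm_num) N

/-- The numerator is odd. -/
theorem coprime_psNumer_two_pow {N : ℕ} (hN : 2 ≤ N) (e : ℕ) : Nat.Coprime (2 ^ e) (psNumer 2 N) :=
  Nat.Coprime.pow_left e (coprime_psNumer 2 hN).symm

/-- Clearing the evaluation of an integer polynomial at `p/D`:
`D^e · Q(p/D) = Σ_{i ≤ e} Q_i p^i D^{e−i}` for `e ≥ natDegree Q`. -/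
def clearedEval (Q : ℤ[X]) (p : ℤ) (D : ℕ) (e : ℕ) : ℤ :=
  ∑ i ∈ Finset.range (e + 1), Q.coeff i * p ^ i * (D : ℤ) ^ (e - i)

/-- The cleared evaluation is `D^e · Q(p/D)` as a real number. -/
theorem clearedEval_cast (Q : ℤ[X]) (p : ℤ) {D : ℕ} (hD : 0 < D) {e : ℕ} (he : Q.natDegree ≤ e) :
    (clearedEval Q p D e : ℝ) = (D : ℝ) ^ e * aeval ((p : ℝ) / D) Q := by
  unfold clearedEval
  have hD' : (D : ℝ) ≠ 0 := by exact_mod_cast hD.ne'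
  rw [aeval_def, eval₂_eq_eval_map, eval_eq_sum_range' (lt_of_le_of_lt natDegree_map_le (Nat.lt_succ_of_le he)),
    Finset.mul_sum]
  push_cast
  refine Finset.sum_congr rfl fun i hi => ?_
  have hi' : i ≤ e := by have := Finset.mem_range.mp hi; omega
  rw [coeff_map, div_pow]
  simp only [algebraMap_int_eq, eq_intCast]
  rw [← pow_sub_mul_pow (D : ℝ) hi']
  field_simp

/-- A non-zero value of an integer polynomial at `p/D` is at least `D^{−e}` in size. -/
theorem abs_aeval_ge_of_ne_zero (Q : ℤ[X]) (p : ℤ) {D : ℕ} (hD : 0 < D) {e : ℕ} (he : Q.natDegree ≤ e)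
    (hne : aeval ((p : ℝ) / D) Q ≠ 0) : 1 / (D : ℝ) ^ e ≤ |aeval ((p : ℝ) / D) Q| := by
  have hc := clearedEval_cast Q p hD he
  have hDpos : (0 : ℝ) < (D : ℝ) ^ e := by positivity
  have hz : clearedEval Q p D e ≠ 0 := by
    intro h0
    rw [h0, Int.cast_zero, eq_comm, mul_eq_zero] at hc
    rcases hc with h | h
    · exact absurd h hDpos.ne'
    · exact hne h
  have h1 : (1 : ℝ) ≤ |(clearedEval Q p D e : ℝ)| := by
    rw [← Int.cast_abs]; exact_mod_cast Int.one_le_abs hz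
  rw [hc, abs_mul, abs_of_pos hDpos] at h1
  rw [div_le_iff₀ hDpos]
  linarith [mul_comm ((D : ℝ) ^ e) |aeval ((p : ℝ) / D) Q|]

/-- If `p/D` (with `gcd(D, p) = 1`) is a root of `Q ≠ 0`, then `D ∣ leadingCoeff Q`; in particular
`D ≤ |leadingCoeff Q|`. -/
theorem dvd_leadingCoeff_of_root (Q : ℤ[X]) {p : ℤ} {D : ℕ} (hD : 0 < D)
    (hcop : IsCoprime (D : ℤ) p) (hroot : aeval ((p : ℝ) / D) Q = 0) :
    (D : ℤ) ∣ Q.leadingCoeff := by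
  set e := Q.natDegree with he
  have hc := clearedEval_cast Q p hD (le_refl e)
  rw [hroot, mul_zero] at hc
  have hz : clearedEval Q p D e = 0 := by exact_mod_cast hc
  -- split off the top term
  unfold clearedEval at hz
  rw [Finset.sum_range_succ, Nat.sub_self, pow_zero, mul_one] at hz
  have hdvd : (D : ℤ) ∣ ∑ i ∈ Finset.range e, Q.coeff i * p ^ i * (D : ℤ) ^ (e - i) := by
    refine Finset.dvd_sum fun i hi => ?_
    have hi' : i < e := Finset.mem_range.mp hi
    obtain ⟨t, ht⟩ : ∃ t, e - i = t + 1 := ⟨e - i - 1, by omega⟩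
    rw [ht, pow_succ]
    exact ⟨Q.coeff i * p ^ i * (D : ℤ) ^ t, by ring⟩
  have htop : (D : ℤ) ∣ Q.coeff e * p ^ e := by
    have : Q.coeff e * p ^ e = -(∑ i ∈ Finset.range e, Q.coeff i * p ^ i * (D : ℤ) ^ (e - i)) := by
      linarith
    rw [this]
    exact (dvd_neg).mpr hdvd
  have hcop' : IsCoprime (D : ℤ) (p ^ e) := hcop.pow_right
  rw [coeff_natDegree] at htop
  exact hcop'.dvd_of_dvd_mul_right htop

/-- Gauss: a rational root `p/D` in lowest terms forces `D ≤ |lc Q|`. -/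
theorem le_abs_leadingCoeff_of_root (Q : ℤ[X]) (hQ : Q ≠ 0) {p : ℤ} {D : ℕ} (hD : 0 < D)
    (hcop : IsCoprime (D : ℤ) p) (hroot : aeval ((p : ℝ) / D) Q = 0) :
    (D : ℤ) ≤ |Q.leadingCoeff| := by
  have h := dvd_leadingCoeff_of_root Q hD hcop hroot
  have hlc : Q.leadingCoeff ≠ 0 := leadingCoeff_ne_zero.mpr hQ
  exact Int.le_of_dvd (abs_pos.mpr hlc) ((dvd_abs _ _).mpr h)

end Truncations

/-! ## §3  Calculus of `P(x, y)`: the `x`-derivative `dX P`, Lipschitz bounds, the TANGENT inequality -/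

section Analysis

/-- `aeval x Q = (Q.map ℤ→ℝ).eval x`. -/
private theorem aeval_eq_eval_map (Q : ℤ[X]) (x : ℝ) : aeval x Q = (Q.map (Int.castRingHom ℝ)).eval x := by
  rw [aeval_def, eval_map, algebraMap_int_eq]

/-- For fixed `y`, `x ↦ P(x, y)` is the real polynomial `fy P y`. -/
def fy (P : ℤ[X][X]) (y : ℝ) : ℝ[X] :=
  ∑ j ∈ Finset.range (P.natDegree + 1), C (y ^ j) * (P.coeff j).map (Int.castRingHom ℝ)

/-- `fy P y` evaluates at `x` to `bev P x y`. -/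
theorem eval_fy (P : ℤ[X][X]) (x y : ℝ) : (fy P y).eval x = bev P x y := by
  rw [bev_eq_sum P (Nat.lt_succ_self _), fy, eval_finsetSum]
  refine Finset.sum_congr rfl fun j _ => ?_
  rw [eval_mul, eval_C, aeval_eq_eval_map]; ring

/-- The derivative of `fy P y` evaluates at `x` to `bev (dX P) x y`. -/
theorem eval_derivative_fy (P : ℤ[X][X]) (x y : ℝ) :
    (derivative (fy P y)).eval x = bev (dX P) x y := by
  rw [bev_eq_sum (dX P) (Nat.lt_succ_of_le (natDegree_dX_le P)), fy, derivative_sum, eval_finsetSum]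
  refine Finset.sum_congr rfl fun j _ => ?_
  rw [derivative_C_mul, eval_mul, eval_C, coeff_dX, aeval_eq_eval_map, derivative_map]; ring

/-- `∂/∂x P(x, y) = (dX P)(x, y)`. -/
theorem hasDerivAt_bev (P : ℤ[X][X]) (x y : ℝ) :
    HasDerivAt (fun t => bev P t y) (bev (dX P) x y) x := by
  have h := (fy P y).hasDerivAt x
  simp only [eval_fy] at h
  rw [eval_derivative_fy] at h
  exact h

/-- `P(x, y)` as an explicit double sum of monomials. -/
theorem bev_eq_double_sum (P : ℤ[X][X]) (x y : ℝ) :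
    bev P x y = ∑ j ∈ Finset.range (P.natDegree + 1),
      (∑ i ∈ Finset.range (xdeg P + 1), (((P.coeff j).coeff i : ℤ) : ℝ) * x ^ i) * y ^ j := by
  rw [bev_eq_sum P (Nat.lt_succ_self _)]
  refine Finset.sum_congr rfl fun j _ => ?_
  rw [aeval_eq_sum_range' (Nat.lt_succ_of_le (natDegree_coeff_le_xdeg P j))]
  simp [Algebra.smul_def]

/-- `(x, y) ↦ P(x, y)` is (jointly) continuous. -/
theorem continuous_bev₂ (P : ℤ[X][X]) : Continuous fun p : ℝ × ℝ => bev P p.1 p.2 := by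
  simp only [bev_eq_double_sum]
  fun_prop

/-- (L1) `y ↦ P(x, y)` is Lipschitz on `[ρ − 1, ρ + 1]`. -/
theorem lipschitz_y (P : ℤ[X][X]) (x ρ : ℝ) : ∃ C₂ : ℝ, 0 < C₂ ∧ ∀ y, |y - ρ| ≤ 1 →
    |bev P x y - bev P x ρ| ≤ C₂ * |y - ρ| := by
  set G : ℝ[X] := P.map (aeval x : ℤ[X] →ₐ[ℤ] ℝ).toRingHom with hGdef
  have hG : ∀ y, bev P x y = G.eval y := fun y => rfl
  obtain ⟨B, hB⟩ := (isCompact_Icc : IsCompact (Set.Icc (ρ - 1) (ρ + 1))).exists_bound_of_continuousOn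
    ((derivative G).continuous.continuousOn)
  refine ⟨max B 1, lt_of_lt_of_le zero_lt_one (le_max_right _ _), fun y hy => ?_⟩
  have hconv : Convex ℝ (Set.Icc (ρ - 1) (ρ + 1)) := convex_Icc _ _
  have hρmem : ρ ∈ Set.Icc (ρ - 1) (ρ + 1) := ⟨by linarith, by linarith⟩
  have hymem : y ∈ Set.Icc (ρ - 1) (ρ + 1) := by
    constructor <;> linarith [(abs_le.mp hy).1, (abs_le.mp hy).2]
  have key := hconv.norm_image_sub_le_of_norm_deriv_le (f := fun t => G.eval t) (C := max B 1)
    (fun t _ => G.differentiableAt) (fun t ht => by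
      rw [Polynomial.deriv]; exact (hB t ht).trans (le_max_left _ _)) hρmem hymem
  simpa [hG, Real.norm_eq_abs] using key

/-- (L3) `x ↦ P(x, y)` is Lipschitz on `[0, 2]`, uniformly for `y ∈ [ρ − 1, ρ + 1]`. -/
theorem lipschitz_x (P : ℤ[X][X]) (ρ : ℝ) : ∃ C₆ : ℝ, 0 < C₆ ∧ ∀ x x' y, x ∈ Set.Icc (0:ℝ) 2 →
    x' ∈ Set.Icc (0:ℝ) 2 → |y - ρ| ≤ 1 → |bev P x y - bev P x' y| ≤ C₆ * |x - x'| := by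
  have hK : IsCompact (Set.Icc (0:ℝ) 2 ×ˢ Set.Icc (ρ - 1) (ρ + 1)) := isCompact_Icc.prod isCompact_Icc
  obtain ⟨B, hB⟩ := hK.exists_bound_of_continuousOn ((continuous_bev₂ (dX P)).continuousOn)
  refine ⟨max B 1, lt_of_lt_of_le zero_lt_one (le_max_right _ _), fun x x' y hx hx' hy => ?_⟩
  have hconv : Convex ℝ (Set.Icc (0:ℝ) 2) := convex_Icc _ _
  have hymem : y ∈ Set.Icc (ρ - 1) (ρ + 1) := by
    constructor <;> linarith [(abs_le.mp hy).1, (abs_le.mp hy).2]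
  have key := hconv.norm_image_sub_le_of_norm_deriv_le (f := fun t => bev P t y) (C := max B 1)
    (fun t _ => (hasDerivAt_bev P t y).differentiableAt)
    (fun t ht => by
      rw [(hasDerivAt_bev P t y).deriv]
      exact (hB (t, y) (Set.mk_mem_prod ht hymem)).trans (le_max_left _ _)) hx' hx
  simpa [Real.norm_eq_abs] using key

/-- (L2) **TANGENT INEQUALITY at a point with `∂P/∂x ≠ 0`.**  Near `(x₀, ρ)`, moving `x` from `x₀` down to
`x'` changes `P(·, y)` by at least `½|∂ₓP(x₀, ρ)|·(x₀ − x')` (mean value theorem + continuity of `∂ₓP`). -/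
theorem tangent (P : ℤ[X][X]) (x₀ ρ : ℝ) (hτ : bev (dX P) x₀ ρ ≠ 0) :
    ∃ δ : ℝ, 0 < δ ∧ ∀ x' y, x' < x₀ → x₀ - x' < δ → |y - ρ| < δ →
      |bev (dX P) x₀ ρ| / 2 * (x₀ - x') ≤ |bev P x₀ y - bev P x' y| := by
  have hcont : ContinuousAt (fun p : ℝ × ℝ => bev (dX P) p.1 p.2) (x₀, ρ) :=
    (continuous_bev₂ (dX P)).continuousAt
  rw [Metric.continuousAt_iff] at hcont
  obtain ⟨δ, hδ, hδ'⟩ := hcont (|bev (dX P) x₀ ρ| / 2) (half_pos (abs_pos.mpr hτ))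
  refine ⟨δ, hδ, fun x' y hx' hxd hyd => ?_⟩
  obtain ⟨ξ, hξ, hslope⟩ := exists_hasDerivAt_eq_slope (fun t => bev P t y) (fun t => bev (dX P) t y)
    hx' (fun t _ => (hasDerivAt_bev P t y).continuousAt.continuousWithinAt)
    (fun t _ => hasDerivAt_bev P t y)
  have hξclose : dist (ξ, y) (x₀, ρ) < δ := by
    rw [Prod.dist_eq, Real.dist_eq, Real.dist_eq]
    refine max_lt ?_ hyd
    rw [abs_sub_lt_iff]; constructor <;> linarith [hξ.1, hξ.2]
  have hnear := hδ' hξclose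
  rw [Real.dist_eq] at hnear
  have hlow : |bev (dX P) x₀ ρ| / 2 ≤ |bev (dX P) ξ y| := by
    have := abs_sub_abs_le_abs_sub (bev (dX P) x₀ ρ) (bev (dX P) ξ y)
    rw [abs_sub_comm] at this
    linarith
  have hpos : 0 < x₀ - x' := by linarith
  have heq : bev P x₀ y - bev P x' y = bev (dX P) ξ y * (x₀ - x') := by
    rw [hslope]; field_simp
  rw [heq, abs_mul, abs_of_pos hpos]
  exact mul_le_mul_of_nonneg_right hlow hpos.le

/-- The coefficients of the cleared specialisation `specX P r`. -/
theorem coeff_specX (P : ℤ[X][X]) (r : ℚ) (i : ℕ) :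
    (specX P r).coeff i = ∑ j ∈ Finset.range (P.natDegree + 1),
      (P.coeff j).coeff i * (r.num ^ j * (r.den : ℤ) ^ (P.natDegree - j)) := by
  unfold specX
  rw [finsetSum_coeff]
  refine Finset.sum_congr rfl fun j _ => ?_
  rw [coeff_mul_C]

/-- (L4) Height of `specX P r` in a window: `|coeff| ≤ C₃(P, R)·den(r)^d` for `|r| ≤ R`. -/
theorem coeff_specX_bound_abs (P : ℤ[X][X]) (R : ℝ) (hR1 : 1 ≤ R) : ∃ C₃ : ℝ, 0 < C₃ ∧ ∀ r : ℚ,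
    |(r : ℝ)| ≤ R → ∀ i, |(((specX P r).coeff i : ℤ) : ℝ)| ≤ C₃ * (r.den : ℝ) ^ P.natDegree := by
  classical
  set d := P.natDegree with hd
  set Λ : ℝ := ∑ j ∈ Finset.range (d + 1), ∑ i ∈ Finset.range (xdeg P + 1),
    |(((P.coeff j).coeff i : ℤ) : ℝ)| with hΛ
  have hΛ0 : 0 ≤ Λ := Finset.sum_nonneg fun _ _ => Finset.sum_nonneg fun _ _ => abs_nonneg _
  refine ⟨Λ * R ^ d + 1, by positivity, fun r hrabs i => ?_⟩
  have hq : (0 : ℝ) < r.den := by exact_mod_cast r.den_pos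
  have hqd1 : (1 : ℝ) ≤ (r.den : ℝ) ^ d := one_le_pow₀ (by exact_mod_cast r.den_pos)
  have hnum : |((r.num : ℤ) : ℝ)| ≤ R * r.den := by
    have e : ((r.num : ℤ) : ℝ) = (r : ℝ) * r.den := by
      rw [Rat.cast_def]; field_simp
    rw [e, abs_mul, abs_of_pos hq]
    exact mul_le_mul_of_nonneg_right hrabs hq.le
  -- each coefficient |c_{ji}| ≤ row sum ≤ Λ-type bound
  have hrow : ∀ j ∈ Finset.range (d + 1), |(((P.coeff j).coeff i : ℤ) : ℝ)| ≤
      ∑ i' ∈ Finset.range (xdeg P + 1), |(((P.coeff j).coeff i' : ℤ) : ℝ)| := by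
    intro j _
    by_cases hi : i ≤ xdeg P
    · exact Finset.single_le_sum (f := fun i' => |(((P.coeff j).coeff i' : ℤ) : ℝ)|)
        (fun _ _ => abs_nonneg _) (Finset.mem_range.mpr (by omega))
    · have : (P.coeff j).coeff i = 0 :=
        coeff_eq_zero_of_natDegree_lt (lt_of_le_of_lt (natDegree_coeff_le_xdeg P j) (by omega))
      rw [this]; simp only [Int.cast_zero, abs_zero]
      exact Finset.sum_nonneg fun _ _ => abs_nonneg _
  rw [coeff_specX]
  push_cast
  calc |∑ j ∈ Finset.range (d + 1), (((P.coeff j).coeff i : ℤ) : ℝ) *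
          (((r.num : ℤ) : ℝ) ^ j * (r.den : ℝ) ^ (d - j))|
      ≤ ∑ j ∈ Finset.range (d + 1), |(((P.coeff j).coeff i : ℤ) : ℝ) *
          (((r.num : ℤ) : ℝ) ^ j * (r.den : ℝ) ^ (d - j))| := Finset.abs_sum_le_sum_abs _ _
    _ ≤ ∑ j ∈ Finset.range (d + 1), (∑ i' ∈ Finset.range (xdeg P + 1),
          |(((P.coeff j).coeff i' : ℤ) : ℝ)|) * (R ^ d * (r.den : ℝ) ^ d) := by
        refine Finset.sum_le_sum fun j hj => ?_
        have hjd : j ≤ d := by have := Finset.mem_range.mp hj; omega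
        rw [abs_mul, abs_mul, abs_pow, abs_pow, abs_of_pos hq]
        refine mul_le_mul (hrow j hj) ?_ (by positivity)
          (Finset.sum_nonneg fun _ _ => abs_nonneg _)
        calc |((r.num : ℤ) : ℝ)| ^ j * (r.den : ℝ) ^ (d - j)
            ≤ (R * r.den) ^ j * (r.den : ℝ) ^ (d - j) :=
              mul_le_mul_of_nonneg_right (pow_le_pow_left₀ (abs_nonneg _) hnum j) (by positivity)
          _ = R ^ j * (r.den : ℝ) ^ d := by
              rw [mul_pow, mul_assoc, ← pow_add, Nat.add_sub_cancel' hjd]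
          _ ≤ R ^ d * (r.den : ℝ) ^ d :=
              mul_le_mul_of_nonneg_right (pow_le_pow_right₀ hR1 hjd) (by positivity)
    _ = Λ * R ^ d * (r.den : ℝ) ^ d := by rw [← Finset.sum_mul, hΛ]; ring
    _ ≤ (Λ * R ^ d + 1) * (r.den : ℝ) ^ d := by nlinarith

/-- (L4) Height of `specX P r`: `|coeff| ≤ C₃(P, ρ)·den(r)^d` for `r` within `1` of `ρ`. -/
theorem coeff_specX_bound (P : ℤ[X][X]) (ρ : ℝ) : ∃ C₃ : ℝ, 0 < C₃ ∧ ∀ r : ℚ, |(r : ℝ) - ρ| ≤ 1 →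
    ∀ i, |(((specX P r).coeff i : ℤ) : ℝ)| ≤ C₃ * (r.den : ℝ) ^ P.natDegree := by
  obtain ⟨C₃, hC₃0, h⟩ := coeff_specX_bound_abs P (|ρ| + 1) (by linarith [abs_nonneg ρ])
  refine ⟨C₃, hC₃0, fun r hr i => h r ?_ i⟩
  have := abs_sub_abs_le_abs_sub (r : ℝ) ρ
  linarith

end Analysis

end Summit.Schanuel.Schanuel.Theorems.RootDecomp1KDegreeLadder

end
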